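import Summits.Ventures.HodgeRepro2.T5InertPlaceCompletion
import Summits.Ventures.HodgeRepro2.T5EvenValuationNorm

/-!
# (u3) on Mathlib's adic completions: a self-dual lattice exists iff `det V` has even valuation
(Tier-5 support, N3)

The N3 record's condition (u3) at an inert place — «`V_v` admits a self-dual `𝔬_{E_v}`-lattice iff
`det V_v` has even valuation» (route-2, N3 v0.15 §N3.10.3, after MVW LNM 1291 Ch. 5 Remarque
(2)(c)) — was put in kernel form on an abstract carrier by `T5SelfDualLatticeDet` (the lattice half)
and `T5EvenValuationNorm` (the valuation reading). This file states it on the RECORD'S LOCAL FIELDS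
`Kv ⊆ Lw` (Mathlib's `adicCompletion` at places `w ∣ v` of number fields `K ⊆ L`, `[Lw : Kv] = 2`,
`e(w/v) = 1`), with the ring of integers of `Lw` spelled either as `𝒪_{E_v} = integralClosure O_Kv Lw`
(`exists_dualLattice_eq_iff_exists_det_eq_mul_zpow_adicCompletion`) or as Mathlib's own
`O_Lw = w.adicCompletionIntegers L` (`…_adicCompletion'`; the two lattices coincide,
`stdLattice_integralClosure_eq` / `dualLattice_integralClosure_eq`). Every instance hypothesis of
the abstract statements is discharged on the concrete pair (`T5InertPlaceCompletion`); `2 ≠ 0`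
from `CharZero Lw`. What stays prose: that the datum's `(E_v, F_v, V_v)` is such a triple. No L-value
anywhere (README §8(d): NO).
-/

namespace Summit.Ventures.HodgeRepro2.T5InertPlaceCompletionLattice

open IsDedekindDomain HeightOneSpectrum IsLocalRing T5InertPlaceCompletion T5UnitaryGroupIsometry

section General

variable {R A B : Type*} [CommRing R] [CommRing A] [CommRing B] [Algebra R B] [Algebra A B]
  [IsIntegralClosure A R B]

/-- The standard lattice `R^ι` is the same set for `integralClosure R B` and for any integral
closure `A`. -/
theorem stdLattice_integralClosure_eq {ι : Type*} :
    stdLattice (integralClosure R B) (E := B) (ι := ι) = stdLattice A (E := B) (ι := ι) := by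
  ext v
  simp only [stdLattice, Set.mem_setOf_eq,
    isInteger_integralClosure_iff_of_isIntegralClosure (A := A)]

/-- The dual of a lattice is the same set for `integralClosure R B` and for any integral closure
`A`. -/
theorem dualLattice_integralClosure_eq [StarRing B] {ι : Type*} [Fintype ι] (J : Matrix ι ι B)
    (L : Set (ι → B)) : dualLattice (integralClosure R B) J L = dualLattice A J L := by
  ext v
  simp only [dualLattice, Set.mem_setOf_eq,
    isInteger_integralClosure_iff_of_isIntegralClosure (A := A)]

end General

section Completion

variable {K : Type*} [Field K] [NumberField K] (v : HeightOneSpectrum (NumberField.RingOfIntegers K))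
  {L : Type*} [Field L] [NumberField L] [Algebra K L]
  (w : HeightOneSpectrum (NumberField.RingOfIntegers L)) [w.asIdeal.LiesOver v.asIdeal]

/-- **(u3) on the record's local fields, `𝒪_{E_v} = integralClosure O_Kv Lw`.** For places `w ∣ v`
with `[Lw : Kv] = 2` and `e(w/v) = 1` (a uniformiser `ϖ` of `O_Kv` stays irreducible in `O_Lw`), `σ`
the Galois conjugation of `Lw/Kv`, and `H` hermitian `3 × 3` over `Lw` with unit determinant and an
isotropic vector: `V = (Lw³, H)` admits a self-dual `𝒪_{E_v}`-lattice iff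
`det H = a · ϖ^(2m)` for some `a ∈ O_Kvˣ`, `m ∈ ℤ` — iff `det H` has even valuation. -/
theorem exists_dualLattice_eq_iff_exists_det_eq_mul_zpow_adicCompletion
    (h2 : Module.finrank (v.adicCompletion K) (w.adicCompletion L) = 2)
    {ϖ : v.adicCompletionIntegers K} (hϖ : Irreducible ϖ)
    (hinert : Irreducible (algebraMap (v.adicCompletionIntegers K) (w.adicCompletionIntegers L) ϖ))
    (σ : (w.adicCompletion L) ≃ₐ[v.adicCompletion K] (w.adicCompletion L)) (hσ : σ ≠ 1)
    {H : Matrix (Fin 3) (Fin 3) (w.adicCompletion L)}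
    (hH : letI := T5StarOfInvolution.starRingOfQuadratic h2 σ hσ; H.IsHermitian)
    (hdet : IsUnit H.det) {e : Fin 3 → w.adicCompletion L} (he : e ≠ 0)
    (he0 : letI := T5StarOfInvolution.starRingOfQuadratic h2 σ hσ; sesqForm H e e = 0) :
    letI := T5StarOfInvolution.starRingOfQuadratic h2 σ hσ
    (∃ Q : Matrix (Fin 3) (Fin 3) (w.adicCompletion L), IsUnit Q ∧
        dualLattice (integralClosure (v.adicCompletionIntegers K) (w.adicCompletion L))
          (Q.conjTranspose * H * Q)
          (stdLattice (integralClosure (v.adicCompletionIntegers K) (w.adicCompletion L))) =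
        stdLattice (integralClosure (v.adicCompletionIntegers K) (w.adicCompletion L))) ↔
      ∃ (a : (v.adicCompletionIntegers K)ˣ) (m : ℤ),
        H.det = algebraMap (v.adicCompletionIntegers K) (w.adicCompletion L) a *
          algebraMap (v.adicCompletionIntegers K) (w.adicCompletion L) ϖ ^ (2 * m) := by
  haveI := isLocalRing_integralClosure_adicCompletion v w
  exact T5EvenValuationNorm.exists_dualLattice_eq_iff_exists_det_eq_mul_zpow_quadratic h2 σ hσ
    (map_maximalIdeal_integralClosure_eq_of_irreducible v w hϖ hinert) hϖ hH hdet two_ne_zero he he0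

/-- **(u3) on the record's local fields, with Mathlib's `O_Lw = w.adicCompletionIntegers L`.**
`V = (Lw³, H)` admits a self-dual `O_Lw`-lattice iff `det H = a · ϖ^(2m)`, `a ∈ O_Kvˣ`, `m ∈ ℤ`. -/
theorem exists_dualLattice_eq_iff_exists_det_eq_mul_zpow_adicCompletion'
    (h2 : Module.finrank (v.adicCompletion K) (w.adicCompletion L) = 2)
    {ϖ : v.adicCompletionIntegers K} (hϖ : Irreducible ϖ)
    (hinert : Irreducible (algebraMap (v.adicCompletionIntegers K) (w.adicCompletionIntegers L) ϖ))
    (σ : (w.adicCompletion L) ≃ₐ[v.adicCompletion K] (w.adicCompletion L)) (hσ : σ ≠ 1)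
    {H : Matrix (Fin 3) (Fin 3) (w.adicCompletion L)}
    (hH : letI := T5StarOfInvolution.starRingOfQuadratic h2 σ hσ; H.IsHermitian)
    (hdet : IsUnit H.det) {e : Fin 3 → w.adicCompletion L} (he : e ≠ 0)
    (he0 : letI := T5StarOfInvolution.starRingOfQuadratic h2 σ hσ; sesqForm H e e = 0) :
    letI := T5StarOfInvolution.starRingOfQuadratic h2 σ hσ
    (∃ Q : Matrix (Fin 3) (Fin 3) (w.adicCompletion L), IsUnit Q ∧
        dualLattice (w.adicCompletionIntegers L) (Q.conjTranspose * H * Q)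
          (stdLattice (w.adicCompletionIntegers L)) = stdLattice (w.adicCompletionIntegers L)) ↔
      ∃ (a : (v.adicCompletionIntegers K)ˣ) (m : ℤ),
        H.det = algebraMap (v.adicCompletionIntegers K) (w.adicCompletion L) a *
          algebraMap (v.adicCompletionIntegers K) (w.adicCompletion L) ϖ ^ (2 * m) := by
  letI := T5StarOfInvolution.starRingOfQuadratic h2 σ hσ
  rw [← exists_dualLattice_eq_iff_exists_det_eq_mul_zpow_adicCompletion v w h2 hϖ hinert σ hσ hH
    hdet he he0]
  simp only [stdLattice_integralClosure_eq (A := w.adicCompletionIntegers L),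
    dualLattice_integralClosure_eq (A := w.adicCompletionIntegers L)]

end Completion

end Summit.Ventures.HodgeRepro2.T5InertPlaceCompletionLattice
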